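import Mathlib.Geometry.Manifold.VectorBundle.CovariantDerivative.Torsion
import Mathlib.Geometry.Manifold.VectorBundle.CovariantDerivative.Metric
import Mathlib.Geometry.Manifold.VectorBundle.Tensoriality
import Literature.Geometry.Lorentzian.PseudoRiemannianMetric
import Literature.Geometry.Lorentzian.Curvature
import HarnessLib

-- provenance: harness21/H21/H21/Prelude/Lorentz/LeviCivita.lean @ b511040 (interim HEAD d8f2665); M5 mechanical rewrite
/-!
# The Levi-Civita connection, metric curvature and the wave operator (trunk G08 = T-LORENTZ, C4)

For a `C^n` pseudo-Riemannian metric `g` on the tangent bundle of a real manifold `M`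
(`g : PseudoRiemannianMetric I n E (TangentSpace I : M → Type _)`) we define

* `g.IsCompatible cov`: the covariant derivative `cov` on `TM` is compatible with `g`
  (`X g(Y,Z) = g(∇_X Y, Z) + g(Y, ∇_X Z)`); `g.IsLeviCivita cov`: torsion-free and compatible;
* `g.koszulFunctional X Y Z x`: the right-hand side of the Koszul formula (`= 2 g(∇_X Y, Z)`);
* `g.leviCivita : CovariantDerivative I E (TangentSpace I : M → Type _)`: **the Levi-Civita
  connection**, a real definition through the Koszul formula and the musical isomorphism;
  `isLeviCivita_leviCivita` (existence) and `IsLeviCivita.eq_leviCivita` (uniqueness),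
  O'Neill 1983, Theorem 3.11;
* `g.riemann x`, `g.ricci x`, `g.scalarCurvature x`, `g.einsteinTensor x`: the curvature tensors of
  `g` (via `CovariantDerivative.curvature/ricci` of `H21/Prelude/Lorentz/Curvature.lean`);
* `g.hessian f x`, `g.dalembertian f x` (`□_g f = tr_g Hess f`), `g.covDeriv₂ k x` (the covariant
  derivative `∇k` of a field of bilinear forms), `g.divergence k x` (`(div k)(Y) = g^{ij} (∇_i k)(e_j, Y)`);
* `g.IsKillingField X`.

## Sources

B. O'Neill, *Semi-Riemannian geometry with applications to relativity* (1983), Ch. 3: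
Thm. 3.11 (Levi-Civita, Koszul formula), Def. 3.9–3.10, Lemma 3.35 ff. (curvature),
Def. 3.48–Lemma 3.49 (Hessian), Lemma 3.52–Def. 3.53 (Ricci, scalar curvature), p. 86 (divergence),
Ch. 9, Def. 9.22 ff. and Prop. 9.25 (Killing fields), Ch. 12, p. 336 (Einstein tensor);
J. M. Lee, *Introduction to Riemannian Manifolds* (2nd ed. 2018), Thm. 5.10, Prop. 4.15 ff.,
(7.24)–(7.26); R. M. Wald, *General Relativity* (1984), (3.1.14), (3.1.29), (3.2.25)–(3.2.28),
(C.3.1) (Killing equation).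

## Mathlib

Mathlib (at the pin) has bundled covariant derivatives `CovariantDerivative I F V`, their torsion
`CovariantDerivative.torsion`, the tensoriality construction `TensorialAt.mkHom/mkHom₂`, and metric
compatibility `CovariantDerivative.IsMetricCompatible` **for Riemannian bundles only** (it is
phrased with `inner`/`InnerProductSpace` fibres, `Mathlib/Geometry/Manifold/VectorBundle/
CovariantDerivative/Metric.lean`); there is no Levi-Civita connection, Koszul formula, Hessian,
Ricci/scalar/Einstein tensor or Killing field (`rg -i 'levi|koszul|christoffel|killing|hessian'
Mathlib/Geometry/Manifold` finds nothing). `IsCompatible` below is the verbatim analogue of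
Mathlib's `CovariantDerivative.isMetricCompatible_iff` with `inner` replaced by `g.val`. We use
Mathlib's `mvfderiv` (derivative of a scalar function as a covector), `VectorField.mlieBracket`,
`FiberBundle.extend`, and the `T%`/`MDiffAt`/`CMDiffAt` elaborators.

## Design

* **Regularity.** The Koszul formula differentiates `g`, so the Levi-Civita connection only exists
  for `C^n` metrics with `1 ≤ n`; since a `CovariantDerivative` admits no junk value, everything from
  `leviCivita` on assumes `[Fact (1 ≤ n)]` (the idiom of `MeasureTheory.Lp`'s `[Fact (1 ≤ p)]`);
  instances for `n = ∞` and `n = ω` are provided, so for smooth or analytic metrics (all target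
  statements) the hypothesis is invisible. Statements needing two derivatives of `g` carry
  `2 ≤ n` explicitly.
* **The definition of `leviCivita`.** Mathlib's covariant derivatives are total functions on *all*
  sections `Y`, meaningful only at points where `Y` is differentiable. The Koszul functional
  `Z ↦ koszulFunctional g X Y Z x` is tensorial in `Z` only when `Y` is differentiable at `x`, so
  the outline's `TensorialAt.mkHom` recipe cannot be fed a true side lemma for arbitrary `Y`.
  Instead `leviCivitaFun g Y x` is *the* continuous linear map `A` with
  `2 g_x(A X₀, Z₀) = koszulFunctional g (extend X₀) Y (extend Z₀) x` for all `X₀, Z₀` when such an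
  `A` exists (it is unique by nondegeneracy, and exists whenever `Y` is differentiable at `x`,
  lemma `exists_leviCivitaFun_repr`), and the junk value `0` otherwise — the pattern of
  `CovariantDerivative.curvature` in `Curvature.lean` and of Mathlib's
  `IsCovariantDerivativeOn.difference`. The single side lemma feeding the definition,
  `isCovariantDerivativeOn_leviCivitaFun` (true for every `C^n` metric with `1 ≤ n`; O'Neill 1983,
  Thm. 3.11), is vendored as a named fact, and — a `CovariantDerivative` admitting no junk value —
  everything from `leviCivita` on assumes its conclusion as the instance hypothesis
  `[g.HasLeviCivita]` (`Fact (IsCovariantDerivativeOn E g.leviCivitaFun univ)`, again the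
  `[Fact (1 ≤ p)]` idiom; supplied from the named fact by `HasLeviCivita.of`); consumers write
  `variable [g.HasLeviCivita]`.
* Every named fact binds its regularity and dimension hypotheses `[Fact (1 ≤ n)]`,
  `[FiniteDimensional ℝ E]`, `[CompleteSpace E]` (and the point `x`) explicitly inside the `Prop`
  (a `def … : Prop` does not inherit unused instance variables of its section), so that no fact is
  asserted for merely continuous metrics or infinite-dimensional model spaces, where they fail.
  The documented fallback `(exists_isLeviCivita g).choose` is therefore not needed.
* **Uniqueness** is stated on differentiable sections only (`IsLeviCivita.eq_leviCivita`): two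
  covariant derivatives in Mathlib's sense may differ arbitrarily on non-differentiable sections.
* The second-order tensors `hessian`, `covDeriv₂` are likewise "the (unique) multilinear map
  representing the classical formula on extended vectors, else `0`"; `hessian_apply`,
  `covDeriv₂_apply` recover the formulas under the natural differentiability hypotheses.
* Argument order: `covDeriv₂ g k x X₀ Y₀ Z₀ = (∇_{Z₀} k)(X₀, Y₀)` (derivative slot last, Lee's
  convention for `∇k`); `divergence g k x Y₀ = tr_g ((X₀, Z₀) ↦ (∇_{Z₀} k)(X₀, Y₀))`.
* No global `FiniteDimensional ℝ (TangentSpace I x)` instance: `TangentSpace I x = E`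
  definitionally and `[FiniteDimensional ℝ E]` is used through `g.trace`/`g.sharp`.
* Sign conventions: `R(X,Y)Z = ∇_X ∇_Y Z - ∇_Y ∇_X Z - ∇_{[X,Y]} Z`, `Ric(X,Y) = tr (v ↦ R(v,X)Y)`
  (from `Curvature.lean`), `S = tr_g Ric`, `G = Ric - (S/2) g`, `Hess f (X,Y) = X(Yf) - (∇_X Y) f`,
  `□_g f = tr_g Hess f = g^{ij} ∇_i ∇_j f`.
-/

noncomputable section

open Bundle Set NormedSpace FiberBundle VectorField
open scoped Manifold ContDiff Topology

namespace Literature.Geometry.Lorentzian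

/-- `1 ≤ ∞` in `ℕ∞ω`, as a `Fact` instance (so that the Levi-Civita API applies to smooth metrics
without further ado; compare Mathlib's `fact_one_le_top_ennreal`). [folklore] -/
instance fact_one_le_infty : Fact (1 ≤ (∞ : ℕ∞ω)) :=
  ⟨by exact_mod_cast le_top⟩

/-- `1 ≤ ω` in `ℕ∞ω`, as a `Fact` instance (analytic metrics; compare Mathlib's
`fact_one_le_top_ennreal`). [folklore] -/
instance fact_one_le_omega : Fact (1 ≤ (ω : ℕ∞ω)) :=
  ⟨le_top⟩

variable {E : Type*} [NormedAddCommGroup E] [NormedSpace ℝ E] {H : Type*} [TopologicalSpace H]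
  {I : ModelWithCorners ℝ E H} {M : Type*} [TopologicalSpace M] [ChartedSpace H M]
  [IsManifold I ∞ M] {n : ℕ∞ω} {x : M}

namespace PseudoRiemannianMetric

variable (g : PseudoRiemannianMetric I n E (TangentSpace I : M → Type _))

/-! ### Metric compatibility and the Levi-Civita property -/

/-- A covariant derivative `∇ = cov` on `TM` is **compatible with the metric** `g` if
`X g(Y, Z) = g(∇_X Y, Z) + g(Y, ∇_X Z)` at every point `x` for all vector fields `X, Y, Z`
differentiable at `x`; the left-hand side is the derivative `mvfderiv` of the scalar function
`y ↦ g_y(Y_y, Z_y)` at `x` applied to `X x` (recall Mathlib's argument order `cov Y x (X x) = ∇_X Y`).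
Verbatim analogue of Mathlib's `CovariantDerivative.isMetricCompatible_iff` for pseudo-Riemannian
`g`. O'Neill 1983, Ch. 3, Thm. 3.11 (D4); Lee, *Riemannian Manifolds*, Prop. 5.5. [cite: ONeill1983, Ch. 3, Thm. 3.11] -/
def IsCompatible (cov : CovariantDerivative I E (TangentSpace I : M → Type _)) : Prop :=
  ∀ ⦃x : M⦄ ⦃X Y Z : Π x : M, TangentSpace I x⦄,
    MDiffAt (T% X) x → MDiffAt (T% Y) x → MDiffAt (T% Z) x →
      mvfderiv I (fun y ↦ g.val y (Y y) (Z y)) x (X x) =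
        g.val x (cov Y x (X x)) (Z x) + g.val x (Y x) (cov Z x (X x))

variable [FiniteDimensional ℝ E] [CompleteSpace E]

/-- A covariant derivative `cov` on `TM` is a **Levi-Civita connection** of `g` if it is
torsion-free (`cov.torsion = 0`, Mathlib) and compatible with `g`.
O'Neill 1983, Ch. 3, Thm. 3.11 (D3)–(D4); Lee, *Riemannian Manifolds*, Thm. 5.10. [cite: ONeill1983, Ch. 3, Thm. 3.11] -/
def IsLeviCivita (cov : CovariantDerivative I E (TangentSpace I : M → Type _)) : Prop :=
  cov.torsion = 0 ∧ g.IsCompatible cov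

/-! ### The Koszul formula and the Levi-Civita connection -/

/-- The **Koszul functional** of `g`: for vector fields `X, Y, Z` and a point `x`,
`K(X,Y,Z)(x) = X g(Y,Z) + Y g(Z,X) - Z g(X,Y) - g(X,[Y,Z]) + g(Y,[Z,X]) + g(Z,[X,Y])`, all
evaluated at `x` (derivatives of scalar functions via `mvfderiv`, brackets via
`VectorField.mlieBracket`). The Koszul formula says `2 g(∇_X Y, Z) = K(X,Y,Z)` for the
Levi-Civita connection. O'Neill 1983, Ch. 3, Thm. 3.11 (Koszul formula); Lee, *Riemannian
Manifolds*, (5.8). [cite: ONeill1983, Ch. 3, Thm. 3.11] -/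
def koszulFunctional (X Y Z : Π x : M, TangentSpace I x) (x : M) : ℝ :=
  mvfderiv I (fun y ↦ g.val y (Y y) (Z y)) x (X x)
    + mvfderiv I (fun y ↦ g.val y (Z y) (X y)) x (Y x)
    - mvfderiv I (fun y ↦ g.val y (X y) (Y y)) x (Z x)
    - g.val x (X x) (mlieBracket I Y Z x) + g.val x (Y x) (mlieBracket I Z X x)
    + g.val x (Z x) (mlieBracket I X Y x)

section Koszul

variable [Fact (1 ≤ n)]

/-- The Koszul functional is tensorial (function-linear) in its last slot `Z` at `x`, provided the
metric is `C^1` and `X`, `Y` are differentiable at `x`: the derivative terms `(Xf) g(Y,Z)` and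
`(Yf) g(Z,X)` produced by `Z ↦ fZ` cancel against those of the brackets `[Y, fZ]`, `[fZ, X]`.
O'Neill 1983, Ch. 3, proof of Thm. 3.11; Lee, *Riemannian Manifolds*, proof of Thm. 5.10. [cite: ONeill1983, Ch. 3, proof of Thm. 3.11] -/
def koszulFunctional_tensorial₃ : Prop :=
  ∀ [Fact (1 ≤ n)] [FiniteDimensional ℝ E] [CompleteSpace E] {x : M} {X Y : Π x : M, TangentSpace I x},
    MDiffAt (T% X) x → MDiffAt (T% Y) x → TensorialAt I E (g.koszulFunctional X Y · x) x

/-- The Koszul functional is tensorial in its first slot `X` at `x`, provided the metric is `C^1`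
and `Y`, `Z` are differentiable at `x`. O'Neill 1983, Ch. 3, proof of Thm. 3.11;
Lee, *Riemannian Manifolds*, proof of Thm. 5.10. [cite: ONeill1983, Ch. 3, proof of Thm. 3.11] -/
def koszulFunctional_tensorial₁ : Prop :=
  ∀ [Fact (1 ≤ n)] [FiniteDimensional ℝ E] [CompleteSpace E] {x : M} {Y Z : Π x : M, TangentSpace I x},
    MDiffAt (T% Y) x → MDiffAt (T% Z) x → TensorialAt I E (g.koszulFunctional · Y Z x) x

open scoped Classical in
/-- The Levi-Civita connection as a bare function `Γ(TM) → Γ(Hom(TM, TM))`: `leviCivitaFun g Y x`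
is the continuous linear map `A = (∇Y)_x : X₀ ↦ ∇_{X₀} Y` characterised through the Koszul formula
`2 g_x(A X₀, Z₀) = K(X̃₀, Y, Z̃₀)(x)` for all tangent vectors `X₀, Z₀` at `x` (extended to local
vector fields by `FiberBundle.extend`), when such a map exists — it is then unique by
nondegeneracy of `g_x`, and it exists whenever `Y` is differentiable at `x`
(`exists_leviCivitaFun_repr`) — and the junk value `0` otherwise. Prefer the bundled
`PseudoRiemannianMetric.leviCivita`. O'Neill 1983, Ch. 3, Thm. 3.11. [cite: ONeill1983, Ch. 3, Thm. 3.11] -/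
def leviCivitaFun (Y : Π x : M, TangentSpace I x) (x : M) :
    TangentSpace I x →L[ℝ] TangentSpace I x :=
  if h : ∃ A : TangentSpace I x →L[ℝ] TangentSpace I x, ∀ X₀ Z₀ : TangentSpace I x,
      2 * g.val x (A X₀) Z₀ = g.koszulFunctional (extend E X₀) Y (extend E Z₀) x
  then h.choose else 0

/-- For a section `Y` differentiable at `x` (and a `C^1` metric), the Koszul functional on extended
vectors is represented by a (unique) continuous linear map through `2 g_x(A X₀, Z₀)`: bilinearity
by `koszulFunctional_tensorial₁/₃`, representability by nondegeneracy (`g.sharp`) on the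
finite-dimensional fibre. O'Neill 1983, Ch. 3, proof of Thm. 3.11. [cite: ONeill1983, Ch. 3, proof of Thm. 3.11] -/
def exists_leviCivitaFun_repr : Prop :=
  ∀ [Fact (1 ≤ n)] [FiniteDimensional ℝ E] [CompleteSpace E] {x : M} {Y : Π x : M, TangentSpace I x},
    MDiffAt (T% Y) x → ∃ A : TangentSpace I x →L[ℝ] TangentSpace I x, ∀ X₀ Z₀ : TangentSpace I x,
      2 * g.val x (A X₀) Z₀ = g.koszulFunctional (extend E X₀) Y (extend E Z₀) x

/-- Defining property of `leviCivitaFun` at a differentiable section: the Koszul formula on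
extended tangent vectors, given representability (the named fact `exists_leviCivitaFun_repr`,
hypothesis `h`). O'Neill 1983, Ch. 3, Thm. 3.11. [cite: ONeill1983, Ch. 3, Thm. 3.11] -/
theorem two_mul_val_leviCivitaFun_apply_eq_extend (h : g.exists_leviCivitaFun_repr)
    {Y : Π x : M, TangentSpace I x} (hY : MDiffAt (T% Y) x) (X₀ Z₀ : TangentSpace I x) :
    2 * g.val x (g.leviCivitaFun Y x X₀) Z₀ =
      g.koszulFunctional (extend E X₀) Y (extend E Z₀) x := by
  have h' := h hY
  simp only [leviCivitaFun, dif_pos h']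
  exact h'.choose_spec X₀ Z₀

/-- **The Koszul function is a covariant derivative.** `leviCivitaFun g` is additive and satisfies
the Leibniz rule at differentiable sections, i.e. it is a covariant derivative on all of `M` in
Mathlib's sense (`IsCovariantDerivativeOn`). This is the computational heart of the existence half
of the fundamental lemma of pseudo-Riemannian geometry; it holds for every `C^n` metric with
`1 ≤ n`. O'Neill 1983, Ch. 3, Thm. 3.11 (existence); Lee, *Riemannian Manifolds*, Thm. 5.10. [cite: ONeill1983, Ch. 3, Thm. 3.11] -/
def isCovariantDerivativeOn_leviCivitaFun : Prop :=
  ∀ [Fact (1 ≤ n)] [FiniteDimensional ℝ E] [CompleteSpace E], IsCovariantDerivativeOn E g.leviCivitaFun univ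

/-- `g.HasLeviCivita`: the standing hypothesis of the Levi-Civita API for a `C^n` metric,
`1 ≤ n`, on a finite-dimensional model space — the conclusion of the named fact
`isCovariantDerivativeOn_leviCivitaFun` (O'Neill 1983, Ch. 3, Thm. 3.11, existence half) at the
ambient instances, packaged as a `Fact` so that it can be assumed as an instance argument
`[g.HasLeviCivita]`; see `HasLeviCivita.of`. [cite: ONeill1983, Ch. 3, Thm. 3.11] -/
abbrev HasLeviCivita : Prop :=
  -- the section instances `[Fact (1 ≤ n)] [FiniteDimensional ℝ E] [CompleteSpace E]` are
  -- parameters of this abbreviation (inherited through `leviCivitaFun`)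
  Fact (IsCovariantDerivativeOn E g.leviCivitaFun univ)

/-- The named fact `isCovariantDerivativeOn_leviCivitaFun` supplies the standing hypothesis
`g.HasLeviCivita`. O'Neill 1983, Ch. 3, Thm. 3.11. [folklore] -/
theorem HasLeviCivita.of (h : g.isCovariantDerivativeOn_leviCivitaFun) : g.HasLeviCivita :=
  ⟨h⟩

variable [g.HasLeviCivita]

/-- The **Levi-Civita connection** of the pseudo-Riemannian metric `g`: the unique torsion-free
covariant derivative on `TM` compatible with `g` (`isLeviCivita_leviCivita`,
`IsLeviCivita.eq_leviCivita`), constructed from the Koszul formula (`leviCivitaFun`), under the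
standing hypothesis `[g.HasLeviCivita]` (the named fact `isCovariantDerivativeOn_leviCivitaFun`).
O'Neill 1983, Ch. 3, Thm. 3.11; Lee, *Riemannian Manifolds*, Thm. 5.10 (fundamental theorem of
Riemannian geometry). [cite: ONeill1983, Ch. 3, Thm. 3.11] -/
def leviCivita : CovariantDerivative I E (TangentSpace I : M → Type _) :=
  ⟨g.leviCivitaFun, Fact.out⟩

omit [FiniteDimensional ℝ E] [CompleteSpace E] [Fact (1 ≤ n)] in
/-- The Levi-Civita connection is `leviCivitaFun` as a function. [folklore] -/
lemma leviCivita_apply (Y : Π x : M, TangentSpace I x) (x : M) :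
    g.leviCivita Y x = g.leviCivitaFun Y x := rfl

/-- **Koszul formula.** For vector fields `X, Y, Z` differentiable at `x`,
`2 g(∇_X Y, Z)(x) = X g(Y,Z) + Y g(Z,X) - Z g(X,Y) - g(X,[Y,Z]) + g(Y,[Z,X]) + g(Z,[X,Y])`.
O'Neill 1983, Ch. 3, Thm. 3.11 (Koszul formula); Lee, *Riemannian Manifolds*, (5.8). [cite: ONeill1983, Ch. 3, Thm. 3.11] -/
def two_mul_val_leviCivita_apply : Prop :=
  ∀ [Fact (1 ≤ n)] [FiniteDimensional ℝ E] [CompleteSpace E] [g.HasLeviCivita] {x : M} {X Y Z : Π x : M, TangentSpace I x},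
    MDiffAt (T% X) x → MDiffAt (T% Y) x → MDiffAt (T% Z) x →
      2 * g.val x (g.leviCivita Y x (X x)) (Z x) = g.koszulFunctional X Y Z x

/-- **Fundamental lemma of pseudo-Riemannian geometry, existence.** The Levi-Civita connection is
torsion-free and compatible with `g`. O'Neill 1983, Ch. 3, Thm. 3.11; Lee, *Riemannian
Manifolds*, Thm. 5.10. [cite: ONeill1983, Ch. 3, Thm. 3.11] -/
def isLeviCivita_leviCivita : Prop :=
  ∀ [Fact (1 ≤ n)] [FiniteDimensional ℝ E] [CompleteSpace E] [g.HasLeviCivita], g.IsLeviCivita g.leviCivita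

variable {g} in
/-- **Fundamental lemma of pseudo-Riemannian geometry, uniqueness.** A torsion-free `g`-compatible
covariant derivative agrees with the Levi-Civita connection on every section differentiable at the
point considered (Mathlib's covariant derivatives are unconstrained on non-differentiable sections,
so equality can only be asserted there). O'Neill 1983, Ch. 3, Thm. 3.11; Lee, *Riemannian
Manifolds*, Thm. 5.10. [cite: ONeill1983, Ch. 3, Thm. 3.11] -/
def IsLeviCivita.eq_leviCivita : Prop :=
  ∀ [Fact (1 ≤ n)] [FiniteDimensional ℝ E] [CompleteSpace E] [g.HasLeviCivita] {cov : CovariantDerivative I E (TangentSpace I : M → Type _)},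
    g.IsLeviCivita cov → ∀ {x : M} {Y : Π x : M, TangentSpace I x}, MDiffAt (T% Y) x →
      cov Y x = g.leviCivita Y x

end Koszul

/-! ### Curvature of the metric -/

section Curvature

variable [Fact (1 ≤ n)] [g.HasLeviCivita]

/-- The **Riemann curvature tensor** `R_x(X, Y) Z` of `g`: the curvature
(`CovariantDerivative.curvature`, convention `R(X,Y)Z = ∇_X ∇_Y Z - ∇_Y ∇_X Z - ∇_{[X,Y]} Z`) of
its Levi-Civita connection. O'Neill 1983, Ch. 3, Lemma 3.35 (up to O'Neill's sign
`R_{XY} = -R(X,Y)`); Lee, *Riemannian Manifolds*, (7.2). [cite: ONeill1983, Ch. 3, Lemma 3.35] -/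
def riemann (x : M) :
    TangentSpace I x →L[ℝ] TangentSpace I x →L[ℝ] TangentSpace I x →L[ℝ] TangentSpace I x :=
  g.leviCivita.curvature x

/-- The **Ricci tensor** `Ric_x(X, Y) = tr (v ↦ R(v, X) Y)` of `g`, a bilinear form on `T_x M`
(`CovariantDerivative.ricci` of the Levi-Civita connection). O'Neill 1983, Ch. 3, Lemma 3.52;
Lee, *Riemannian Manifolds*, (7.24). [cite: ONeill1983, Ch. 3, Lemma 3.52] -/
def ricci (x : M) : LinearMap.BilinForm ℝ (TangentSpace I x) :=
  g.leviCivita.ricci x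

omit [FiniteDimensional ℝ E] [CompleteSpace E] [Fact (1 ≤ n)] in
/-- `ricci` unfolds to the Ricci tensor of the Levi-Civita connection. [folklore] -/
lemma ricci_apply (X₀ Y₀ : TangentSpace I x) :
    g.ricci x X₀ Y₀ = g.leviCivita.ricci x X₀ Y₀ := rfl

/-- The Ricci tensor of a `C^2` metric is symmetric. O'Neill 1983, Ch. 3, Lemma 3.52
(consequence of pair symmetry, Prop. 3.36 (4)); Lee, *Riemannian Manifolds*, Prop. 7.14 ff. [cite: ONeill1983, Ch. 3, Lemma 3.52] -/
def ricci_symm : Prop :=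
  ∀ [Fact (1 ≤ n)] [FiniteDimensional ℝ E] [CompleteSpace E] [g.HasLeviCivita], 2 ≤ n → ∀ x : M, (g.ricci x).IsSymm

/-- The **scalar curvature** `S(x) = tr_g Ric_x = g^{ij} Ric_{ij}` of `g` (metric contraction
`g.trace` of the Ricci tensor). O'Neill 1983, Ch. 3, Def. 3.53; Lee, *Riemannian Manifolds*,
(7.26). [cite: ONeill1983, Ch. 3, Def. 3.53] -/
def scalarCurvature (x : M) : ℝ :=
  g.trace x (g.ricci x)

/-- The **Einstein tensor** `G = Ric - (S/2) g` of `g` at `x`, as a bilinear form on `T_x M`.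
O'Neill 1983, Ch. 12, p. 336; Wald, *General Relativity*, (3.2.28). [cite: ONeill1983, Ch. 12, p. 336] -/
def einsteinTensor (x : M) : LinearMap.BilinForm ℝ (TangentSpace I x) :=
  g.ricci x - (g.scalarCurvature x / 2) • g.toBilinForm x

omit [CompleteSpace E] [Fact (1 ≤ n)] in
/-- Unfolding lemma for the Einstein tensor: `G(X,Y) = Ric(X,Y) - (S/2) g(X,Y)`.
Wald, *General Relativity*, (3.2.28). [folklore] -/
@[simp]
lemma einsteinTensor_apply (X₀ Y₀ : TangentSpace I x) :
    g.einsteinTensor x X₀ Y₀ = g.ricci x X₀ Y₀ - g.scalarCurvature x / 2 * g.val x X₀ Y₀ := by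
  simp [einsteinTensor]

/-- The Einstein tensor of a `C^2` metric is symmetric, given symmetry of the Ricci tensor (the
named fact `ricci_symm`, hypothesis `hr`). Wald, *General Relativity*, §3.2. [folklore] -/
theorem einsteinTensor_symm (hr : g.ricci_symm) (hn : 2 ≤ n) (x : M) :
    (g.einsteinTensor x).IsSymm :=
  ⟨fun X₀ Y₀ ↦ by rw [einsteinTensor_apply, einsteinTensor_apply, (hr hn x).eq X₀ Y₀,
    g.symm x X₀ Y₀]⟩

/-- Sanity check: the named facts bind their regularity/dimension hypotheses and the point. -/
example : g.ricci_symm ↔ ∀ [Fact (1 ≤ n)] [FiniteDimensional ℝ E] [CompleteSpace E]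
    [g.HasLeviCivita], 2 ≤ n → ∀ x : M, (g.ricci x).IsSymm := Iff.rfl

end Curvature

/-! ### Hessian and wave operator -/

section Hessian

variable [Fact (1 ≤ n)] [g.HasLeviCivita]

/-- The Hessian of a function as a bare operation on vector fields:
`hessianAux g f X Y x = X(Y f)(x) - ((∇_X Y) f)(x)` (all derivatives via `mvfderiv`).
Prefer the tensor `PseudoRiemannianMetric.hessian`. O'Neill 1983, Ch. 3, Def. 3.48 and
Lemma 3.49 (`H^f(X,Y) = XYf - (∇_X Y)f`). [cite: ONeill1983, Ch. 3, Def. 3.48 and Lemma 3.49] -/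
def hessianAux (f : M → ℝ) (X Y : Π x : M, TangentSpace I x) (x : M) : ℝ :=
  mvfderiv I (fun y ↦ mvfderiv I f y (Y y)) x (X x) - mvfderiv I f x (g.leviCivita Y x (X x))

open scoped Classical in
/-- The **Hessian** `Hess f = ∇(df)` of `f : M → ℝ` at `x`, as a bilinear form on `T_x M`:
the unique bilinear form agreeing with `hessianAux g f` on extended tangent vectors when one
exists (e.g. when `f` is `C^2` at `x`, `hessian_apply`), and the junk value `0` otherwise.
O'Neill 1983, Ch. 3, Def. 3.48; Lee, *Riemannian Manifolds*, Example 4.22 / (5.13). [cite: ONeill1983, Ch. 3, Def. 3.48] -/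
def hessian (f : M → ℝ) (x : M) : LinearMap.BilinForm ℝ (TangentSpace I x) :=
  if h : ∃ B : LinearMap.BilinForm ℝ (TangentSpace I x), ∀ X₀ Y₀ : TangentSpace I x,
      B X₀ Y₀ = g.hessianAux f (extend E X₀) (extend E Y₀) x
  then h.choose else 0

/-- For `f` of class `C^2` at `x` and vector fields `X, Y` differentiable at `x`,
`Hess f (X, Y)(x) = X(Yf)(x) - ((∇_X Y) f)(x)`. O'Neill 1983, Ch. 3, Def. 3.48–Lemma 3.49. [cite: ONeill1983, Ch. 3, Def. 3.48–Lemma 3.49] -/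
def hessian_apply : Prop :=
  ∀ [Fact (1 ≤ n)] [FiniteDimensional ℝ E] [CompleteSpace E] [g.HasLeviCivita] {x : M} {f : M → ℝ}, CMDiffAt 2 f x →
    ∀ {X Y : Π x : M, TangentSpace I x}, MDiffAt (T% X) x → MDiffAt (T% Y) x →
      g.hessian f x (X x) (Y x) = g.hessianAux f X Y x

/-- The Hessian of a `C^2` function is symmetric (the Levi-Civita connection is torsion-free).
O'Neill 1983, Ch. 3, Lemma 3.49. [cite: ONeill1983, Ch. 3, Lemma 3.49] -/
def hessian_symm : Prop :=
  ∀ [Fact (1 ≤ n)] [FiniteDimensional ℝ E] [CompleteSpace E] [g.HasLeviCivita] {x : M} {f : M → ℝ}, CMDiffAt 2 f x → (g.hessian f x).IsSymm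

/-- The **d'Alembertian** (wave operator, Laplace–Beltrami operator of `g`)
`□_g f (x) = tr_g Hess f = g^{ij} ∇_i ∇_j f`. O'Neill 1983, Ch. 3, Def. 3.50 ff. (Laplacian
`Δf = div grad f = tr Hess f`); Wald, *General Relativity*, p. 445 (`□ = ∇^a ∇_a`). [cite: ONeill1983, Ch. 3, Def. 3.50 ff.] -/
def dalembertian (f : M → ℝ) (x : M) : ℝ :=
  g.trace x (g.hessian f x)

end Hessian

/-! ### Covariant derivative and divergence of a field of bilinear forms -/

section CovDeriv

variable [Fact (1 ≤ n)] [g.HasLeviCivita]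

/-- The covariant derivative of a field of bilinear forms `k` as a bare operation on vector fields:
`covDeriv₂Aux g k X Y Z x = (∇_Z k)(X, Y)(x) = Z(k(X,Y))(x) - k_x(∇_Z X, Y) - k_x(X, ∇_Z Y)`.
Prefer the tensor `PseudoRiemannianMetric.covDeriv₂`. O'Neill 1983, Ch. 3, Def. 3.9–3.10 and
Prop. 3.18 (tensor derivations, covariant differential); Lee, *Riemannian Manifolds*, Prop. 4.15. [cite: ONeill1983, Ch. 3, Def. 3.9–3.10 and Prop. 3.18] -/
def covDeriv₂Aux (k : Π x : M, TangentSpace I x →L[ℝ] TangentSpace I x →L[ℝ] ℝ)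
    (X Y Z : Π x : M, TangentSpace I x) (x : M) : ℝ :=
  mvfderiv I (fun y ↦ k y (X y) (Y y)) x (Z x)
    - k x (g.leviCivita X x (Z x)) (Y x) - k x (X x) (g.leviCivita Y x (Z x))

open scoped Classical in
/-- The **covariant derivative** `∇k` of a field of continuous bilinear forms `k` on `TM` at `x`,
as a continuous trilinear map with `covDeriv₂ g k x X₀ Y₀ Z₀ = (∇_{Z₀} k)(X₀, Y₀)` (derivative slot
last): the unique trilinear map agreeing with `covDeriv₂Aux g k` on extended tangent vectors when
one exists (e.g. when `k` is differentiable at `x`, `covDeriv₂_apply`), junk value `0` otherwise.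
O'Neill 1983, Ch. 3, Def. 3.10 and Prop. 3.18; Lee, *Riemannian Manifolds*, Prop. 4.15–4.17. [cite: ONeill1983, Ch. 3, Def. 3.10 and Prop. 3.18] -/
def covDeriv₂ (k : Π x : M, TangentSpace I x →L[ℝ] TangentSpace I x →L[ℝ] ℝ) (x : M) :
    TangentSpace I x →L[ℝ] TangentSpace I x →L[ℝ] TangentSpace I x →L[ℝ] ℝ :=
  if h : ∃ K : TangentSpace I x →L[ℝ] TangentSpace I x →L[ℝ] TangentSpace I x →L[ℝ] ℝ,
      ∀ X₀ Y₀ Z₀ : TangentSpace I x,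
        K X₀ Y₀ Z₀ = g.covDeriv₂Aux k (extend E X₀) (extend E Y₀) (extend E Z₀) x
  then h.choose else 0

/-- For a field of bilinear forms `k` differentiable at `x` (as a section of `Hom(TM, Hom(TM, ℝ))`)
and vector fields `X, Y, Z` differentiable at `x`,
`(∇k)_x(X, Y, Z) = Z(k(X,Y))(x) - k_x(∇_Z X, Y) - k_x(X, ∇_Z Y)`.
O'Neill 1983, Ch. 3, Prop. 3.18; Lee, *Riemannian Manifolds*, Prop. 4.15. [cite: ONeill1983, Ch. 3, Prop. 3.18] -/
def covDeriv₂_apply : Prop :=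
  ∀ [Fact (1 ≤ n)] [FiniteDimensional ℝ E] [CompleteSpace E] [g.HasLeviCivita] {x : M}
    {k : Π x : M, TangentSpace I x →L[ℝ] TangentSpace I x →L[ℝ] ℝ},
    MDifferentiableAt I (I.prod 𝓘(ℝ, E →L[ℝ] E →L[ℝ] ℝ))
      (fun y ↦ TotalSpace.mk' (E →L[ℝ] E →L[ℝ] ℝ)
        (E := fun y : M ↦ TangentSpace I y →L[ℝ] TangentSpace I y →L[ℝ] ℝ) y (k y)) x →
    ∀ {X Y Z : Π x : M, TangentSpace I x}, MDiffAt (T% X) x → MDiffAt (T% Y) x → MDiffAt (T% Z) x →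
      g.covDeriv₂ k x (X x) (Y x) (Z x) = g.covDeriv₂Aux k X Y Z x

/-- The metric is parallel: `∇g = 0` (metric compatibility of the Levi-Civita connection).
O'Neill 1983, Ch. 3, Thm. 3.11 and Cor. 3.13 (3). [cite: ONeill1983, Ch. 3, Thm. 3.11 and Cor. 3.13] -/
def covDeriv₂_val : Prop :=
  ∀ [Fact (1 ≤ n)] [FiniteDimensional ℝ E] [CompleteSpace E] [g.HasLeviCivita] (x : M), g.covDeriv₂ g.val x = 0

/-- The bilinear form `(X₀, Z₀) ↦ (∇_{Z₀} k)(X₀, Y₀)` whose metric trace is the divergence of `k`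
evaluated at `Y₀`. O'Neill 1983, Ch. 3, p. 86 (divergence as contraction of `∇k`). [cite: ONeill1983, Ch. 3, p. 86] -/
def divergenceAux (k : Π x : M, TangentSpace I x →L[ℝ] TangentSpace I x →L[ℝ] ℝ) (x : M)
    (Y₀ : TangentSpace I x) : LinearMap.BilinForm ℝ (TangentSpace I x) :=
  LinearMap.mk₂ ℝ (fun X₀ Z₀ ↦ g.covDeriv₂ k x X₀ Y₀ Z₀)
    (fun X₀ X₁ Z₀ ↦ by simp) (fun c X₀ Z₀ ↦ by simp)
    (fun X₀ Z₀ Z₁ ↦ by simp) (fun c X₀ Z₀ ↦ by simp)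

omit [FiniteDimensional ℝ E] [CompleteSpace E] [Fact (1 ≤ n)] in
/-- Unfolding lemma for `divergenceAux`. [folklore] -/
@[simp]
lemma divergenceAux_apply (k : Π x : M, TangentSpace I x →L[ℝ] TangentSpace I x →L[ℝ] ℝ)
    (Y₀ X₀ Z₀ : TangentSpace I x) :
    g.divergenceAux k x Y₀ X₀ Z₀ = g.covDeriv₂ k x X₀ Y₀ Z₀ := rfl

/-- The **divergence** of a field of bilinear forms `k` at `x`, the covector
`(div k)_x(Y₀) = g^{ij} (∇_{e_i} k)(e_j, Y₀)`: the metric trace of `∇k` over the derivative slot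
and the first slot. For symmetric `k` this is the divergence entering the momentum constraint and
the contracted Bianchi identity `div G = 0`. O'Neill 1983, Ch. 3, p. 86; Wald, *General
Relativity*, (3.2.30), (10.2.29). [cite: ONeill1983, Ch. 3, p. 86] -/
def divergence (k : Π x : M, TangentSpace I x →L[ℝ] TangentSpace I x →L[ℝ] ℝ) (x : M) :
    TangentSpace I x →ₗ[ℝ] ℝ where
  toFun Y₀ := g.trace x (g.divergenceAux k x Y₀)
  map_add' Y₀ Y₁ := by
    have h : g.divergenceAux k x (Y₀ + Y₁) = g.divergenceAux k x Y₀ + g.divergenceAux k x Y₁ :=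
      LinearMap.ext₂ fun X₀ Z₀ ↦ by simp
    simp only [trace, h, LinearMap.comp_add, map_add]
  map_smul' c Y₀ := by
    have h : g.divergenceAux k x (c • Y₀) = c • g.divergenceAux k x Y₀ :=
      LinearMap.ext₂ fun X₀ Z₀ ↦ by simp
    simp only [trace, h, LinearMap.comp_smul, map_smul, RingHom.id_apply]

omit [CompleteSpace E] [Fact (1 ≤ n)] in
/-- Unfolding lemma for the divergence. O'Neill 1983, Ch. 3, p. 86. [cite: ONeill1983, Ch. 3, p. 86] -/
lemma divergence_apply (k : Π x : M, TangentSpace I x →L[ℝ] TangentSpace I x →L[ℝ] ℝ)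
    (Y₀ : TangentSpace I x) :
    g.divergence k x Y₀ = g.trace x (g.divergenceAux k x Y₀) := rfl

end CovDeriv

/-! ### Killing fields -/

section Killing

variable [Fact (1 ≤ n)] [g.HasLeviCivita]

/-- A vector field `X` on `M` is a **Killing field** of `g` if it is `C^n` (as a section of `TM`)
and satisfies the Killing equation `g(∇_Y X, Z) + g(Y, ∇_Z X) = 0` for all tangent vectors
`Y, Z` at every point (i.e. `∇X` is `g`-skew, equivalently `𝓛_X g = 0`). Recall Mathlib's argument
order `cov X x Y₀ = ∇_{Y₀} X`. O'Neill 1983, Ch. 9, Def. 9.22 and Prop. 9.25;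
Wald, *General Relativity*, (C.3.1). [cite: ONeill1983, Ch. 9, Def. 9.22 and Prop. 9.25] -/
def IsKillingField (X : Π x : M, TangentSpace I x) : Prop :=
  CMDiff n (T% X) ∧
    ∀ (x : M) (Y₀ Z₀ : TangentSpace I x),
      g.val x (g.leviCivita X x Y₀) Z₀ + g.val x Y₀ (g.leviCivita X x Z₀) = 0

variable {g} in
omit [FiniteDimensional ℝ E] [CompleteSpace E] [Fact (1 ≤ n)] in
/-- A Killing field is `C^n`. O'Neill 1983, Ch. 9, Def. 9.22. [cite: ONeill1983, Ch. 9, Def. 9.22] -/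
lemma IsKillingField.contMDiff {X : Π x : M, TangentSpace I x} (h : g.IsKillingField X) :
    CMDiff n (T% X) := h.1

variable {g} in
omit [FiniteDimensional ℝ E] [CompleteSpace E] [Fact (1 ≤ n)] in
/-- The Killing equation `g(∇_Y X, Z) + g(Y, ∇_Z X) = 0`. O'Neill 1983, Ch. 9, Prop. 9.25;
Wald, *General Relativity*, (C.3.1). [cite: ONeill1983, Ch. 9, Prop. 9.25] -/
lemma IsKillingField.val_leviCivita_add {X : Π x : M, TangentSpace I x} (h : g.IsKillingField X)
    (x : M) (Y₀ Z₀ : TangentSpace I x) :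
    g.val x (g.leviCivita X x Y₀) Z₀ + g.val x Y₀ (g.leviCivita X x Z₀) = 0 := h.2 x Y₀ Z₀

omit [FiniteDimensional ℝ E] [CompleteSpace E] [Fact (1 ≤ n)] in
/-- The zero vector field is a Killing field. O'Neill 1983, Ch. 9, p. 250. [cite: ONeill1983, Ch. 9, p. 250] -/
lemma isKillingField_zero : g.IsKillingField 0 := by
  refine ⟨contMDiff_zeroSection ℝ (TangentSpace I : M → Type _), fun x Y₀ Z₀ ↦ ?_⟩
  simp [g.leviCivita.zero]

end Killing

end PseudoRiemannianMetric

end Literature.Geometry.Lorentzian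

end
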